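import Summits.BirchSwinnertonDyer.Rank1Residual.ManinAdditive.ShimuraCuspLifting
import Literature.NumberTheory.EllipticCurves.ManinConstantGamma1Gamma0Comparison
import HarnessLib
import HarnessLib.Audit.Tags

/-!
# THE CUSP ANNIHILATOR LAW E-es-80 `CuspZeroAnnihilatesShimuraQuotient` (cell `bsd-f2-manin`, D-0131 (3) frontier; lens es =
# Euler system / explicit reciprocity; planner es g21, MEMO-es §34) — typed by the cell typer g14 (T-es-27, 2026-08-28T18:32:37Z)
# VERBATIM from HOME/es/Sketch-es-g21.lean sha16 d3d43905b6bde05c §0–§2 (farm rc 0 · 0 warnings · 0 sorries; BC7 3/3 CLEAN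
# HOME/es/g21/g21-bc7.raw.txt 7d5180fd004fb087), namespace `BsdF2ManinEsG21` ↦ `…ManinAdditive.KatoCurve`, the law tagged as an
# obligation node; §3 (E-es-82 `CuspidalMuThreeAtNine`, untested sketch, D-es-25 pending) and §4 (E-es-83
# `ManinValuationsAgreeOfCuspOrderCoprime`, no census yet, REF1 R-es-41 pending) are DELIBERATELY NOT landed here — §4 is
# appended after R-es-41.  TYPER FRAMING: E-es-80 is a THEOREM on paper (Θ) and statement-EQUIVALENT (both directions PROVED
# in §2) to an's landed E-an-128♭ `ShimuraPrimePowerDividesCuspZeroOrder` (`ShimuraCuspLifting.lean`, an has priority: MEMO-an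
# §69.2′); BC5 = census E21 below (1025/1025, 0 failures; eclib cross-check 30/30); REF1 R-es-41 (audit of THEOREM Θ) PENDING at
# filing — a finding is repaired under a NEW name (append-only); NOT in print as stated (nearest: [Stevens1989, §2, La. 3.11],
# [Vatsal2005, Thm. 1.17], Wiersema–Wuthrich 2020 La. 9 / Prop. 10 (arXiv:2004.05492), [LingOesterle1991]).  bears_on:
# stmt-BirchSwinnertonDyer-22968 / 22967.  PARTITION 0 · beyond-print theorem: yes on paper modulo R-es-41, no in Lean ·
# BSD is not proved by this; Manin's conjecture is not proved by this.

es g21 VERBATIM: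

THEOREM Θ («explicit reciprocity at the cusp», MEMO-es §34.2; a second, torsor-free proof of an's cusp-lifting family
E-an-128♭/♮/128/128₄, valid for every prime power and also for `J₀(N)`):  let `E₁ = ℂ/Λ₁(f)`, `E₀ = ℂ/Λ₀(f)`,
`θ : E₁ → E₀` the Shimura isogeny, `K = ker θ = Λ₀/Λ₁ ⊂ E₁(ℚ)` (constant), `P₁ = φ₁(0) ∈ E₁(ℚ(ζ_N))` the image of the
cusp `0` of the `μ_N`-model of `X₁(N)`.  Galois moves the cusp `0` of `X₁(N)` through the diamond operators
(`σ_b(0) = ⟨b⟩0`), and `φ₁∘⟨d⟩ = φ₁ + [{∞, γ_d ∞}_f]`, so the Galois coboundary of `P₁` IS the diamond character: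
`σ_b P₁ − P₁ = π(b)`, `π : (ℤ/N)ˣ ↠ K`.  If `m·φ₀(0) = O` in `E₀` then `m P₁ ∈ θ⁻¹(O) = K ⊂ E₁(ℚ)`, hence
`m·π ≡ 0`, i.e. `m·K = 0`:  **every `m` with `m{∞,0}_f ∈ Λ₀(f)` kills `Λ₀(f)/Λ₁(f)`** — the law E-es-80 below.
Conversely E-es-80 ⟺ E-an-128♭ (PROVED both ways in §2, using the tree's `φ(N)·Λ₀ ⊆ Λ₁`).

BC5 (HOME/es/E21-CUSP-ANNIHILATOR-v1.tsv sha16 a06b420ee817c6a9, script E21-CUSP-ANNIHILATOR-v1.py e6ed11541c8ca2b2):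
1025 optimal classes (all 99 Manin-gain classes `N ≤ 20000` + every class `N ≤ 500`; full index `n = [Λ₀:Λ₁]` from
E15-LATTICE-INDEX-v1, two PARI engines): analytic rank 0 (635 classes) — `n ∣ ord φ(0) = denom(L(E₀,1)/ω₁)` in 635/635
(`n = 2`: 73/73, `n = 3`: 23/23, `n = 4`: 2/2 = 15a1, 17a1 with `ord φ(0) = 4`, `n = 5`: 11a1); analytic rank > 0
(390 classes) — `n = 1` in 390/390 (Θ(ii): `Λ₀ ≠ Λ₁ ⟹ L(f,1) ≠ 0`).  0 failures.

Nothing is asserted: §1 is a `def … : Prop` (law), §2 are sorry-free edges, §3 is a conjecture SKETCH not for landing.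
-/

open scoped Classical MatrixGroups ModularForm
open CongruenceSubgroup Complex WeierstrassCurve Literature.NumberTheory.EllipticCurves
  Literature.NumberTheory.EllipticCurves.ModularForms
open Summit.BirchSwinnertonDyer.Rank1Residual.ManinAdditive.KatoCurve
  Summit.BirchSwinnertonDyer.Rank1Residual.ManinAdditive.CuspidalKummer

namespace Summit.BirchSwinnertonDyer.Rank1Residual.ManinAdditive.KatoCurve

/-! ### §0. Subgroup arithmetic helpers -/

/-- `n·x ∈ Λ` for `x ∈ Λ`, `n : ℕ`. (es g21 helper.) -/
theorem natCast_mul_mem {Λ : AddSubgroup ℂ} {x : ℂ} (hx : x ∈ Λ) (n : ℕ) : (n : ℂ) * x ∈ Λ := by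
  simpa [nsmul_eq_mul] using Λ.nsmul_mem hx n

/-- `n·x ∈ Λ` for `x ∈ Λ`, `n : ℤ`. (es g21 helper.) -/
theorem intCast_mul_mem {Λ : AddSubgroup ℂ} {x : ℂ} (hx : x ∈ Λ) (n : ℤ) : (n : ℂ) * x ∈ Λ := by
  simpa [zsmul_eq_mul] using Λ.zsmul_mem hx n

/-- Bézout in `Λ`: `a·x ∈ Λ` and `b·x ∈ Λ` give `gcd(a,b)·x ∈ Λ`. -/
theorem gcd_mul_mem {Λ : AddSubgroup ℂ} {x : ℂ} {a b : ℕ} (ha : (a : ℂ) * x ∈ Λ) (hb : (b : ℂ) * x ∈ Λ) :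
    ((Nat.gcd a b : ℕ) : ℂ) * x ∈ Λ := by
  have h : ((Nat.gcd a b : ℕ) : ℂ) = (a : ℂ) * (Nat.gcdA a b : ℂ) + (b : ℂ) * (Nat.gcdB a b : ℂ) := by
    have := congrArg (fun z : ℤ => (z : ℂ)) (Nat.gcd_eq_gcd_ab a b)
    push_cast at this
    exact this
  rw [h, add_mul, mul_comm (a : ℂ), mul_assoc, mul_comm (b : ℂ), mul_assoc]
  exact Λ.add_mem (intCast_mul_mem ha _) (intCast_mul_mem hb _)

/-! ### §1. The law -/

/-- **E-es-80 `CuspZeroAnnihilatesShimuraQuotient`** (THEOREM Θ on paper, MEMO-es §34.2; typed as a law): for the newform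
`f` of an elliptic curve, every `m : ℕ` with `m·{∞,0}_f ∈ Λ₀(f)` (i.e. `m·φ₀((0) − (∞)) = O` on `E₀ = ℂ/Λ₀(f)`)
annihilates the Shimura quotient: `m·Λ₀(f) ⊆ Λ₁(f)`.  Equivalently (§2): `exp(Λ₀/Λ₁) ∣ ord φ₀(0)`; equivalently E-an-128♭
for every prime power.  Why it might fail: only through the analytic dictionary (`ℂ/Λ₁(f)` is the `X₁(N)`-optimal curve with
`φ₁` defined over `ℚ` on the `μ_N`-model, `∞ ↦ O`; Stevens 1989 §2, Ling–Oesterlé 1991, Vatsal 2005 Thm 1.17) and the Galois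
action on the `0`-cusps of `X₁(N)` (Stevens 1989 La. 3.11 = Wiersema–Wuthrich 2020 La. 9); the coboundary computation is two lines.
Sources: arXiv:2004.05492 §3 (La. 9, Prop. 10); doi:10.4171/dm/450 Thm 4 / La. 6; Vatsal2005 Thm 1.17; census E21 (1025/1025).
TYPER FRAMING: see the module docstring (⟺ E-an-128♭, PROVED below; BC5 E21 1025/1025; REF1 R-es-41 PENDING).  OPEN in Lean.
[cite: Stevens1989, §2, La. 3.11 (shape only: the `X₁(N)`-optimal parametrisation and the Galois action on the `0`-cusps; the annihilator law is the cell's E-es-80 = an's E-an-128♭ — es MEMO-es §34, an MEMO-an §69.2′)] -/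
@[conjecture]
def CuspZeroAnnihilatesShimuraQuotient : Prop :=
  ∀ (W : WeierstrassCurve ℚ) [W.IsElliptic] {N : ℕ} [NeZero N] (D : ModularParametrizationData W N) (m : ℕ),
    (m : ℂ) * modularSymbol D.f 0 ∈ periodLattice D.f →
    ∀ x ∈ periodLattice D.f, (m : ℂ) * x ∈ periodLatticeGamma1 D.f

/-! ### §2. PROVED edges -/

/-- E-es-80 ⟹ E-an-128♭ (every prime `ℓ`, every `k ≥ 1`), by Bézout. -/
theorem shimuraPrimePowerDividesCuspZeroOrder_of_annihilator (h : CuspZeroAnnihilatesShimuraQuotient) :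
    ShimuraPrimePowerDividesCuspZeroOrder := by
  intro W _ N _ D ℓ k hℓ _hk hx m hm hmem
  obtain ⟨x, hxΛ, hℓk, hℓk1⟩ := hx
  have hmx : (m : ℂ) * x ∈ periodLatticeGamma1 D.f := h W D m hmem x hxΛ
  have hg : ((Nat.gcd m (ℓ ^ k) : ℕ) : ℂ) * x ∈ periodLatticeGamma1 D.f := gcd_mul_mem hmx hℓk
  obtain ⟨j, hjk, hj⟩ := (Nat.dvd_prime_pow hℓ).1 (Nat.gcd_dvd_right m (ℓ ^ k))
  have hjlt : j < k := by
    rcases hjk.lt_or_eq with hlt | heq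
    · exact hlt
    · exfalso; apply hm; rw [← heq, ← hj]; exact Nat.gcd_dvd_left m (ℓ ^ k)
  apply hℓk1
  have hsplit : ℓ ^ (k - 1) = ℓ ^ (k - 1 - j) * ℓ ^ j := by
    rw [← pow_add]; congr 1; omega
  rw [hsplit, Nat.cast_mul, mul_assoc, ← hj]
  exact natCast_mul_mem hg _

/-- E-an-128♭ ⟹ E-es-80 (the Shimura quotient is finite: `φ(N)·Λ₀ ⊆ Λ₁`, tree `totient_mul_mem_periodLatticeGamma1`;
apply 128♭ to each prime power of the order of `x̄ ∈ Λ₀/Λ₁`).  Hence E-es-80 ⟺ E-an-128♭ unconditionally. -/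
theorem annihilator_of_shimuraPrimePowerDividesCuspZeroOrder (h : ShimuraPrimePowerDividesCuspZeroOrder) :
    CuspZeroAnnihilatesShimuraQuotient := by
  intro W _ N _ D m hmem x hx
  have hex : ∃ n : ℕ, 0 < n ∧ (n : ℂ) * x ∈ periodLatticeGamma1 D.f :=
    ⟨Nat.totient N, Nat.totient_pos.mpr (NeZero.pos N), totient_mul_mem_periodLatticeGamma1 D.f hx⟩
  have ho : 0 < Nat.find hex ∧ ((Nat.find hex : ℕ) : ℂ) * x ∈ periodLatticeGamma1 D.f := Nat.find_spec hex
  have hmin : ∀ n : ℕ, 0 < n → (n : ℂ) * x ∈ periodLatticeGamma1 D.f → Nat.find hex ≤ n :=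
    fun n hn hnx => Nat.find_min' hex ⟨hn, hnx⟩
  set o := Nat.find hex with ho_def
  suffices hom : o ∣ m by
    obtain ⟨c, rfl⟩ := hom
    rw [Nat.cast_mul, mul_comm (o : ℂ), mul_assoc]
    exact natCast_mul_mem ho.2 _
  by_cases hm0 : m = 0
  · rw [hm0]; exact dvd_zero o
  refine (Nat.factorization_prime_le_iff_dvd ho.1.ne' hm0).1 fun ℓ hℓ => ?_
  by_contra hlt
  push Not at hlt
  set k := o.factorization ℓ with hk_def
  have hk : 1 ≤ k := by omega
  obtain ⟨o', ho'⟩ : ℓ ^ k ∣ o := Nat.ordProj_dvd o ℓ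
  have ho'pos : 0 < o' := by
    refine Nat.pos_of_ne_zero ?_
    rintro rfl
    rw [mul_zero] at ho'
    exact ho.1.ne' ho'
  have hy : (o' : ℂ) * x ∈ periodLattice D.f := natCast_mul_mem hx _
  have h1 : ((ℓ ^ k : ℕ) : ℂ) * ((o' : ℂ) * x) ∈ periodLatticeGamma1 D.f := by
    rw [← mul_assoc, ← Nat.cast_mul, ← ho']; exact ho.2
  have h2 : ((ℓ ^ (k - 1) : ℕ) : ℂ) * ((o' : ℂ) * x) ∉ periodLatticeGamma1 D.f := by
    intro hmem'
    rw [← mul_assoc, ← Nat.cast_mul] at hmem'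
    have hpos : 0 < ℓ ^ (k - 1) * o' := Nat.mul_pos (pow_pos hℓ.pos _) ho'pos
    have hle := hmin _ hpos hmem'
    rw [ho'] at hle
    have hA : ℓ ^ (k - 1) * o' < ℓ ^ k * o' :=
      mul_lt_mul_of_pos_right (Nat.pow_lt_pow_right hℓ.one_lt (by omega)) ho'pos
    exact absurd hle (not_le.mpr hA)
  have hnot : ¬ ℓ ^ k ∣ m := by
    rw [hℓ.pow_dvd_iff_le_factorization hm0]; exact not_le.mpr hlt
  exact h W D ℓ k hℓ hk ⟨_, hy, h1, h2⟩ m hnot hmem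

/-- E-es-80 ⟹ E-an-128♮ for EVERY prime (the `ℓ ≠ 2` binder of 128♮ is not used). -/
theorem cuspZeroOrder_of_annihilator (h : CuspZeroAnnihilatesShimuraQuotient)
    (W : WeierstrassCurve ℚ) [W.IsElliptic] {N : ℕ} [NeZero N] (D : ModularParametrizationData W N) {ℓ : ℕ}
    (hℓ : ℓ.Prime) (hS : ¬ ShimuraIndexPrimeTo ℓ D.f) {m : ℕ} (hm : ¬ ℓ ∣ m) :
    (m : ℂ) * modularSymbol D.f 0 ∉ periodLattice D.f := by
  intro hmem
  apply hS
  intro x hx hℓx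
  have hg := gcd_mul_mem (h W D m hmem x hx) hℓx
  have h1 : Nat.gcd m ℓ = 1 := ((Nat.Prime.coprime_iff_not_dvd hℓ).2 hm).symm
  simpa [h1] using hg

/-- E-es-80 ⟹ E-an-128♮ as typed (odd primes). -/
theorem shimuraOddPrimeForcesCuspZeroOrder_of_annihilator (h : CuspZeroAnnihilatesShimuraQuotient) :
    ShimuraOddPrimeForcesCuspZeroOrder :=
  shimuraOddPrimeForcesCuspZeroOrder_of_primePower (shimuraPrimePowerDividesCuspZeroOrder_of_annihilator h)

/-- COPRIME-ORDER CRITERION (the form the BSD_p closers consume): if some `m` prime to `p` has `m{∞,0}_f ∈ Λ₀(f)`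
(e.g. `p ∤ #E₀(ℚ)_tors`, or `p ∤ ord φ₀(0)`), then the Shimura index is prime to `p` — i.e. `T_p E₀ = T_p E₁`,
the Kato lattice at `p` is the same for `X₀`- and `X₁`-parametrisations. -/
theorem shimuraIndexPrimeTo_of_cuspZeroOrder_coprime (h : CuspZeroAnnihilatesShimuraQuotient)
    (W : WeierstrassCurve ℚ) [W.IsElliptic] {N : ℕ} [NeZero N] (D : ModularParametrizationData W N)
    {p m : ℕ} (hp : p.Prime) (hpm : ¬ p ∣ m) (hm : (m : ℂ) * modularSymbol D.f 0 ∈ periodLattice D.f) :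
    ShimuraIndexPrimeTo p D.f := by
  by_contra hS
  exact cuspZeroOrder_of_annihilator h W D hp hS hpm hm

/-- … and hence the plus index is prime to `p` (tree `plusIndexPrimeTo_of_shimuraIndexPrimeTo`). -/
theorem plusIndexPrimeTo_of_cuspZeroOrder_coprime (h : CuspZeroAnnihilatesShimuraQuotient)
    (W : WeierstrassCurve ℚ) [W.IsElliptic] {N : ℕ} [NeZero N] (D : ModularParametrizationData W N)
    {p m : ℕ} (hp : p.Prime) (hpm : ¬ p ∣ m) (hm : (m : ℂ) * modularSymbol D.f 0 ∈ periodLattice D.f) :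
    PlusIndexPrimeTo p D.f :=
  plusIndexPrimeTo_of_shimuraIndexPrimeTo hp D.f (shimuraIndexPrimeTo_of_cuspZeroOrder_coprime h W D hp hpm hm)

/-- **E-es-81** (PROVED modulo E-es-80; Θ(ii)): if `L(f,1) = {∞,0}_f = 0` (analytic rank ≥ 1) then `Λ₀(f) = Λ₁(f)`:
the `X₀(N)`- and `X₁(N)`-optimal curves COINCIDE, so `c₀ = c₁` and every Manin statement at every prime is the same for
both parametrisations (census: all 390 positive-rank classes of E21 have index 1; all 99 gain classes have rank 0). -/
theorem periodLattice_eq_periodLatticeGamma1_of_modularSymbol_zero (h : CuspZeroAnnihilatesShimuraQuotient)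
    (W : WeierstrassCurve ℚ) [W.IsElliptic] {N : ℕ} [NeZero N] (D : ModularParametrizationData W N)
    (h0 : modularSymbol D.f 0 = 0) : periodLattice D.f = periodLatticeGamma1 D.f := by
  refine le_antisymm (fun x hx => ?_) (periodLatticeGamma1_le_periodLattice D.f)
  have := h W D 1 (by rw [h0, mul_zero]; exact (periodLattice D.f).zero_mem) x hx
  simpa using this

/-- In particular `ShimuraIndexPrimeTo p` and `PlusIndexPrimeTo p` hold at EVERY prime in positive analytic rank. -/
theorem shimuraIndexPrimeTo_of_modularSymbol_zero (h : CuspZeroAnnihilatesShimuraQuotient)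
    (W : WeierstrassCurve ℚ) [W.IsElliptic] {N : ℕ} [NeZero N] (D : ModularParametrizationData W N)
    (h0 : modularSymbol D.f 0 = 0) {p : ℕ} (hp : p.Prime) : ShimuraIndexPrimeTo p D.f :=
  shimuraIndexPrimeTo_of_cuspZeroOrder_coprime h W D (m := 1) hp
    (by intro hd; exact hp.one_lt.ne' (Nat.dvd_one.mp hd))
    (by rw [h0, mul_zero]; exact (periodLattice D.f).zero_mem)

/-! ### §4. The étale-Shimura comparison E-es-83 (THEOREM on paper modulo Θ; typed as a law) and its C2/C3-facing edge

Θ ⟹ `p ∤ ord φ₀(0)` ⟹ `p ∤ [Λ₀:Λ₁] = deg θ` ⟹ `θ : E₁ → E₀` is étale at `p` (`θ^∨∘θ = [deg θ]`) ⟹ `θ^*ω₀ = u·ω₁` with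
`p ∤ u`, and `c₀ = u·c₁` (pull `ω₀` back along `φ₀∘π = θ∘φ₁`, `π : X₁(N) → X₀(N)`; ČNS Lemma 6.5 exact form `c₀ = n_θ c₁`):
`ord_p(c₀) = ord_p(c₁)`.  So on the locus «the cuspidal point `φ₀((0) − (∞))` has order prime to `p`» (which contains «`E₀(ℚ)`
has no `p`-torsion», hence every `p ≥ 11`, and at `p = 3`, `27 ∣ N` the whole torsion-free locus of C3) Manin at `p` for the
`X₀(N)`-optimal curve IS Manin at `p` for Stevens' `X₁(N)`-optimal curve.  (At `4 ∣ N`: `ord φ₀(0)` odd ⟹ `E₁ = E₀`, since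
`Λ₀/Λ₁` is a `2`-group there.)  Compare an's Γ₀/Γ₁ ledger at `p = 2` (`ShimuraLedger.TotallyBlindGammaOneTransfer`: hypothesis
«all rational 2-torsion blind»); E-es-83's hypothesis is the cusp order, any `p`. -/

/-- **E-es-83 `ManinValuationsAgreeOfCuspOrderCoprime`** (THEOREM on paper modulo Θ = E-es-80 and ČNS Lemma 6.5 in its exact
form; typed as a law): for the `X₁(N)`-optimal `W₁` (`D₁.IsOptimal`) and the `X₀(N)`-optimal `W₀` of one isogeny class and a
prime `p`, if some `m` prime to `p` has `m·{∞,0}_f ∈ Λ₀(f)` then `ord_p(c₀) = ord_p(c₁)`.  Why it might fail: the exact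
form `c₀ = n_θ·c₁` of ČNS 6.5 (tree holds only `c₁ ∣ c₀`) and «`deg θ` prime to `p` ⟹ `n_θ` prime to `p`» at an ADDITIVE
prime (Néron functoriality for an isogeny of degree prime to `p`: standard, `θ^∨θ = [n]`).  Sources: CesnaviciusNeururerSaha2023
La. 6.5; Cesnavicius2018 La. 2.12 / Prop. 2.13; Stevens1989 §2; this file §1. 
TYPER FRAMING (appended by the cell typer g14 from es's ready-to-propose T-es-27 v2, HOME/es/T-es-27-ShimuraCuspAnnihilator.lean
sha16 f65d6e06373c3625 §4 VERBATIM, es GO 2026-08-28T18:38:26Z): lens es; THEOREM on paper MODULO Θ (E-es-80) and the exact form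
`c₀ = n_θ·c₁` of [CesnaviciusNeururerSaha2023, La. 6.5] (the tree holds only `c₁ ∣ c₀`), typed as a LAW; no separate census
(its content is structural; E21 witnesses the hypothesis side); REF1 R-es-41 PENDING at filing — a finding is repaired under a NEW
name (append-only).  Compare an's `ShimuraLedger.TotallyBlindGammaOneTransfer` (p = 2, blind-torsion hypothesis).  OPEN in Lean.
[cite: CesnaviciusNeururerSaha2023, La. 6.5 (shape only: `c₁ ∣ c₀` via the Shimura cover; the valuation-equality law on the coprime-cusp-order locus is the cell's E-es-83 — es MEMO-es §34)] -/
@[conjecture]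
def ManinValuationsAgreeOfCuspOrderCoprime : Prop :=
  ∀ (W₁ W₀ : WeierstrassCurve ℚ) [W₁.IsElliptic] [W₁.IsGloballyMinimal] [W₀.IsElliptic] [W₀.IsGloballyMinimal]
    {N : ℕ} [NeZero N] (D₁ : Gamma1ParametrizationData W₁ N) (D₀ : ModularParametrizationData W₀ N) (p m : ℕ),
    p.Prime → IsIsogenous W₁ W₀ → D₁.IsOptimal → (∀ z ∈ D₀.L.lattice, ∃ w ∈ periodLattice D₀.f, z = D₀.c * w) →
    ¬ p ∣ m → (m : ℂ) * modularSymbol D₀.f 0 ∈ periodLattice D₀.f →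
    padicValInt p D₀.maninConstant = padicValInt p D₁.maninConstant

/-- PROVED edge (the C2/C3-facing form): on the locus `p ∤ ord φ₀(0)`, `p ∤ c₁ ⟹ p ∤ c₀` — Manin at `p` for `X₀(N)` follows
from Stevens' Manin at `p` for `X₁(N)` (the converse `p ∤ c₀ ⟹ p ∤ c₁` is the tree's
`not_dvd_maninConstant₁_of_not_dvd_maninConstant₀` from ČNS 6.5, unconditionally in the cusp order). -/
theorem not_dvd_maninConstant₀_of_not_dvd_maninConstant₁ (h : ManinValuationsAgreeOfCuspOrderCoprime)
    (W₁ W₀ : WeierstrassCurve ℚ) [W₁.IsElliptic] [W₁.IsGloballyMinimal] [W₀.IsElliptic] [W₀.IsGloballyMinimal]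
    {N : ℕ} [NeZero N] (D₁ : Gamma1ParametrizationData W₁ N) (D₀ : ModularParametrizationData W₀ N) {p m : ℕ}
    (hp : p.Prime) (hiso : IsIsogenous W₁ W₀) (h₁ : D₁.IsOptimal)
    (h₀ : ∀ z ∈ D₀.L.lattice, ∃ w ∈ periodLattice D₀.f, z = D₀.c * w)
    (hpm : ¬ p ∣ m) (hm : (m : ℂ) * modularSymbol D₀.f 0 ∈ periodLattice D₀.f)
    (hc₁ : ¬ (p : ℤ) ∣ D₁.maninConstant) : ¬ (p : ℤ) ∣ D₀.maninConstant := by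
  haveI : Fact p.Prime := ⟨hp⟩
  intro hc₀
  have hv := h W₁ W₀ D₁ D₀ p m hp hiso h₁ h₀ hpm hm
  have h0 : D₀.maninConstant ≠ 0 := D₀.maninConstant_ne_zero_holds
  have hv0 : 1 ≤ padicValInt p D₀.maninConstant := by
    rcases (padicValInt_dvd_iff (p := p) 1 D₀.maninConstant).1 (by simpa using hc₀) with h | h
    · exact absurd h h0
    · exact h
  apply hc₁
  have : 1 ≤ padicValInt p D₁.maninConstant := hv ▸ hv0
  simpa using (padicValInt_dvd_iff (p := p) 1 D₁.maninConstant).2 (Or.inr this)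

/-! ### v3 APPEND (T-es-28, es g22 GO 2026-08-28T19:15:22Z; typer g14): the Θ⁺ laws E-es-84♯ / E-es-84♭ — §3 of
HOME/es/Sketch-es-g21b.lean sha16 ec4b3ecb9f8a6ac9 VERBATIM (es g21/g22, MEMO-es §35, CORRECTED §35.6) + the one edge that does not
mention the refuted v1.  NOT landed, by design and for ever: §1 E-es-84 v1 `CuspZeroGeneratesShimuraQuotient` (REFUTED ON PAPER,
Θ⁺ (✗): 17a1 has `ord_{Λ₁}{∞,0}_f = 8`, not 16 — refuter-1 §R82 confirmed independently) and the §2/§3 edges out of it.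
TYPER FRAMING: lens es; both rows THEOREMS on paper (Θ⁺ (♯)/(♭)) modulo FACT A (constancy of `Λ₀/Λ₁ ⊂ E₁`), Θ(iii) (= E-es-80
above) and — for ♭'s proof route only — FACT A′ (`K` cyclic; E15 1025/1025); REF1 §R82 (R-es-42, 2026-08-28T19:08:43Z): (δ) PASS
re-derived, E-es-84♯/♭ SURVIVE A1–A6, BC7 by name 4/4 CLEAN vs C3/C2, edge axioms standard, docstring notes N1/N2 adopted by es
(this text).  BC5: 24 odd-index gain classes `N ≤ 20000` (♯; 11a1: `ord P₁ = 25`), all 1025 E15 classes on paper (♭); the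
two-sided numerical test is data ask D-es-26 / engine E23 (pending at filing; predictions `r = n` odd-index, `r = n/2` for the 52
even-index cyclic-2-torsion gain classes).  NOT in print (nearest: [Stevens1989, §2–3]; Mazur 1977 Prop. II.11.11 = the (✗)
phenomenon at prime level; [LingOesterle1991]).  bears_on: stmt-BirchSwinnertonDyer-22968 / 22967.  Beyond-print theorem: no in
Lean.  BSD is not proved by this.

### §3 (es VERBATIM). The REPAIRED laws (both THEOREMS on paper by Θ⁺): E-es-84♯ (odd Shimura index) and E-es-84♭ (up to 2) -/

/-- **E-es-84♯ `CuspZeroGeneratesShimuraQuotientOfOddIndex`** (THEOREM on paper, Θ⁺ (♯)): if `Λ₀(f)/Λ₁(f)` has no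
`2`-torsion (odd Shimura index, the tree's `ShimuraIndexPrimeTo 2`), then `Λ₀(f) ⊆ Λ₁(f) + ℤ·{∞,0}_f` — the cuspidal
point `a·φ₁(0̃)` generates `ker(E₁ → E₀)`.  Why it might fail: only through FACT A (`ker θ^∨ ≅ μ_n` Galois-equivariantly,
i.e. the constancy of `Λ₀/Λ₁ ⊂ E₁`; Ling–Oesterlé 1991, Vatsal 2005 Rem. 1.8) and Θ(iii) (`n ∣ a`, E-es-80 = law
`CuspZeroAnnihilatesShimuraQuotient`).  BC5: 24 odd-index gain classes (11a1 numerically: `ord P₁ = 25`), E23 pending.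
TYPER FRAMING: see the section docstring (REF1 §R82: SURVIVES; D-es-26 pending).  OPEN in Lean.
[cite: Stevens1989, §2 (shape only; the odd-index generation law is the cell's E-es-84♯ — es MEMO-es §35.6)] -/
@[conjecture]
def CuspZeroGeneratesShimuraQuotientOfOddIndex : Prop :=
  ∀ (W : WeierstrassCurve ℚ) [W.IsElliptic] {N : ℕ} [NeZero N] (D : ModularParametrizationData W N),
    ShimuraIndexPrimeTo 2 D.f →
    ∀ x ∈ periodLattice D.f, ∃ y ∈ periodLatticeGamma1 D.f, ∃ k : ℤ, x = y + (k : ℂ) * modularSymbol D.f 0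

/-- **E-es-84♭ `CuspZeroGeneratesShimuraQuotientUpToTwo`** (THEOREM on paper, Θ⁺ (♭)): `2·Λ₀(f) ⊆ Λ₁(f) + ℤ·{∞,0}_f`
always — the cuspidal point generates a subgroup of index `e ≤ 2` of `ker(E₁ → E₀)`, `e = 2` iff `(a/2)·φ₀(0)` is the
rational point of `ker θ^∨`.  On paper mod FACT A + Θ(iii) + FACT A′ (`K = Λ₀/Λ₁` CYCLIC; E15 1025/1025), A′ used
exactly once, in `n ∣ a·ord(c)` (REF1 §R82 N2); the bound `e ≤ 2` itself needs no cyclicity: `ker θ^∨ = E₀ ∩ Σ(N)` is of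
`μ`-type, so its `ℚ`-points are killed by `2` (§R82 N1).  Why it might fail: only through FACT A / A′ / Θ(iii) as for
E-es-84♯ (dropping A′ leaves ♭ plausible but unproved).  BC5: all 1025 E15 classes on paper; E23 pending
(predictions: `r := ord_{Λ₁}{∞,0}/ord_{Λ₀}{∞,0} = n` for the 24 odd-index and `= n/2` for the 52 even-index
cyclic-2-torsion gain classes, `∈ {n, n/2}` for the other 23).
TYPER FRAMING: see the section docstring (REF1 §R82: SURVIVES, «say mod A′» adopted; D-es-26 pending).  OPEN in Lean.
[cite: Stevens1989, §2 (shape only; the index-≤-2 generation law is the cell's E-es-84♭ — es MEMO-es §35.6)] -/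
@[conjecture]
def CuspZeroGeneratesShimuraQuotientUpToTwo : Prop :=
  ∀ (W : WeierstrassCurve ℚ) [W.IsElliptic] {N : ℕ} [NeZero N] (D : ModularParametrizationData W N),
    ∀ x ∈ periodLattice D.f, ∃ y ∈ periodLatticeGamma1 D.f, ∃ k : ℤ, 2 * x = y + (k : ℂ) * modularSymbol D.f 0

/-- ♭ with `{∞,0}_f ∈ Λ₁` gives `2Λ₀ ⊆ Λ₁` (so an odd Shimura index forces `Λ₀ = Λ₁`; cf. E-es-81). -/
theorem two_mul_mem_of_upToTwo (h : CuspZeroGeneratesShimuraQuotientUpToTwo)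
    (W : WeierstrassCurve ℚ) [W.IsElliptic] {N : ℕ} [NeZero N] (D : ModularParametrizationData W N)
    (h0 : modularSymbol D.f 0 ∈ periodLatticeGamma1 D.f) :
    ∀ x ∈ periodLattice D.f, (2 : ℂ) * x ∈ periodLatticeGamma1 D.f := by
  intro x hx
  obtain ⟨y, hy, k, hk⟩ := h W D x hx
  rw [hk]
  exact (periodLatticeGamma1 D.f).add_mem hy (intCast_mul_mem h0 k)

end Summit.BirchSwinnertonDyer.Rank1Residual.ManinAdditive.KatoCurve
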